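import Summits.CriticalPhenomena.PercolationContinuityZ3.Theorems.PercNearOneGluingNoHeavyLowerTailSahiE3ExchangeCross
import Mathlib.Tactic.Linarith
import Mathlib.Tactic.Ring
import Mathlib.Tactic.Positivity
import HarnessLib
import HarnessLib.Audit

/-!
# `NoHeavyLowerTail` (crux stmt-CriticalPhenomena-4575), Sahi programme P4: the OR-peel at level `z₂` — the top Bernstein coefficient (`G'` true) is nonnegative

Support file (cell `prim-l12`, seat P4, generation 23; `--supports stmt-CriticalPhenomena-4575`).  No named facts, no sorries;
standard axioms; def-free; certificate-free.

Context (HOME prim-l12-p4/FROM-prim-l12-p4-gen23-FLAGSHIP-LEVEL0.md F6/§5).  The flagship `(x₀(x₁∨x₂)) ∨ (y₀(y₁∨y₂))` needs the OR-peel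
differences `D₂, D₁ ≥ 0` at level `(Q',G') = (Bool_{z₂}, {z₂})`; as cubics in `p₂ = P(z₂)` their four Bernstein coefficients are
`c3, c2, c1, c0` with `c0 =` the level-`∅` exchange expression of the column-0 configuration and (for BOTH `D₂` and `D₁`, HOME
code/gen23/sym/colsym.py)
  `c3 = [w(PP'V) + w(OO'V) − w(P)w(O'V) − w(P')w(OV)] + [w(KK'V) + w(LL'V) − w(K)w(L'V) − w(K')w(LV)]
        + (1−v)·[w(PP') + w(KK') − w(K)w(P') − w(P)w(K')]`
for the column-1 configuration `O ⊆ K∩L`, `K∪L ⊆ P` (and primed) — the exchange expression "at `G'` = TRUE", where the `K`-layer sees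
the whole block and no certificate enters.  THEOREM `exchange_gtrue`: `c3 ≥ 0` for every weight `w ≥ 0` of total mass `≤ 1` on a finite
set, every `V`, every such configuration, given six Harris-type product bounds (true for up-sets under an FKG weight):
`w(P)w(O'V) ≤ w(PO'V)`, `w(P')w(OV) ≤ w(OP'V)`, `w(K)w(L'V) ≤ w(KL'V)`, `w(K')w(LV) ≤ w(LK'V)`, `w(K)w(P') ≤ w(KP')`, `w(P)w(K') ≤ w(PK')`.
Proof: after the Harris bounds the `V`-part is `Σ_{b∈V} w_b[(1_P−1_O)(1_{P'}−1_{O'}) + (1_K−1_L)(1_{K'}−1_{L'})]_b ≥ 0` pointwise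
(`1_P − 1_O ≥ |1_K − 1_L|` under the nestings) and the `(1−v)`-part is `Σ_b w_b (1_P−1_K)(1_{P'}−1_{K'}) ≥ 0`.
-/

namespace Summit.CriticalPhenomena.PercolationContinuityZ3.Theorems.SahiE3ExchangeGTrue

open Finset SahiE3DimerPacking SahiE3ExchangeCross
open scoped BigOperators

variable {B : Type*} [DecidableEq B]

/-- **Pointwise core.**  For `w ≥ 0` on `V` and a configuration `O ⊆ K∩L`, `K∪L ⊆ P`, `O' ⊆ K'∩L'`, `K'∪L' ⊆ P'`:
`w(PO'V) + w(OP'V) + w(KL'V) + w(LK'V) ≤ w(PP'V) + w(OO'V) + w(KK'V) + w(LL'V)`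
(pointwise `(1_P−1_O)(1_{P'}−1_{O'}) + (1_K−1_L)(1_{K'}−1_{L'}) ≥ 0`). [this work] -/
theorem gtrue_pointwise (w : B → ℝ) (V P K L O P' K' L' O' : Finset B) (hw : ∀ b ∈ V, 0 ≤ w b)
    (hOK : O ⊆ K) (hOL : O ⊆ L) (hKP : K ⊆ P) (hLP : L ⊆ P)
    (hOK' : O' ⊆ K') (hOL' : O' ⊆ L') (hKP' : K' ⊆ P') (hLP' : L' ⊆ P') :
    (∑ b ∈ (P ∩ O') ∩ V, w b) + (∑ b ∈ (O ∩ P') ∩ V, w b) + (∑ b ∈ (K ∩ L') ∩ V, w b) + (∑ b ∈ (L ∩ K') ∩ V, w b)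
      ≤ (∑ b ∈ (P ∩ P') ∩ V, w b) + (∑ b ∈ (O ∩ O') ∩ V, w b) + (∑ b ∈ (K ∩ K') ∩ V, w b) + (∑ b ∈ (L ∩ L') ∩ V, w b) := by
  simp only [sum_inter_eq_sum_ite, ← Finset.sum_add_distrib]
  refine Finset.sum_le_sum fun b hb => ?_
  have hwb := hw b hb
  have hOP : O ⊆ P := hOK.trans hKP
  have hOP' : O' ⊆ P' := hOK'.trans hKP'
  simp only [Finset.mem_inter]
  by_cases hp : b ∈ P <;> by_cases hk : b ∈ K <;> by_cases hl : b ∈ L <;> by_cases ho : b ∈ O <;>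
  by_cases hp' : b ∈ P' <;> by_cases hk' : b ∈ K' <;> by_cases hl' : b ∈ L' <;> by_cases ho' : b ∈ O' <;>
    simp only [hp, hk, hl, ho, hp', hk', hl', ho', and_true, and_false, and_self, ↓reduceIte, add_zero, zero_add, le_refl] <;>
    first
      | exact absurd (hOK ho) hk
      | exact absurd (hOL ho) hl
      | exact absurd (hKP hk) hp
      | exact absurd (hLP hl) hp
      | exact absurd (hOK' ho') hk'
      | exact absurd (hOL' ho') hl'
      | exact absurd (hKP' hk') hp'
      | exact absurd (hLP' hl') hp'
      | linarith

/-- **Level-`z₂` top coefficient (`G'` true) is nonnegative.**  `B` finite, `w ≥ 0` of total mass `1`, any `V ⊆ B`, a configuration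
`O ⊆ K∩L`, `K∪L ⊆ P`, `O' ⊆ K'∩L'`, `K'∪L' ⊆ P'`, and six Harris-type product bounds.  Then
`[w(PP'V) + w(OO'V) − w(P)w(O'V) − w(P')w(OV)] + [w(KK'V) + w(LL'V) − w(K)w(L'V) − w(K')w(LV)] + (1−v)[w(PP') + w(KK') − w(K)w(P') − w(P)w(K')] ≥ 0`.
[this work] -/
theorem exchange_gtrue [Fintype B] (w : B → ℝ) (hw : ∀ b, 0 ≤ w b) (hw1 : ∑ b, w b = 1)
    (V P K L O P' K' L' O' : Finset B)
    (hOK : O ⊆ K) (hOL : O ⊆ L) (hKP : K ⊆ P) (hLP : L ⊆ P)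
    (hOK' : O' ⊆ K') (hOL' : O' ⊆ L') (hKP' : K' ⊆ P') (hLP' : L' ⊆ P')
    (hHar₁ : (∑ b ∈ P, w b) * (∑ b ∈ O' ∩ V, w b) ≤ ∑ b ∈ (P ∩ O') ∩ V, w b)
    (hHar₂ : (∑ b ∈ P', w b) * (∑ b ∈ O ∩ V, w b) ≤ ∑ b ∈ (O ∩ P') ∩ V, w b)
    (hHar₃ : (∑ b ∈ K, w b) * (∑ b ∈ L' ∩ V, w b) ≤ ∑ b ∈ (K ∩ L') ∩ V, w b)
    (hHar₄ : (∑ b ∈ K', w b) * (∑ b ∈ L ∩ V, w b) ≤ ∑ b ∈ (L ∩ K') ∩ V, w b)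
    (hHar₅ : (∑ b ∈ K, w b) * (∑ b ∈ P', w b) ≤ ∑ b ∈ K ∩ P', w b)
    (hHar₆ : (∑ b ∈ P, w b) * (∑ b ∈ K', w b) ≤ ∑ b ∈ P ∩ K', w b) :
    0 ≤ ((∑ b ∈ (P ∩ P') ∩ V, w b) + (∑ b ∈ (O ∩ O') ∩ V, w b)
          - (∑ b ∈ P, w b) * (∑ b ∈ O' ∩ V, w b) - (∑ b ∈ P', w b) * (∑ b ∈ O ∩ V, w b))
        + ((∑ b ∈ (K ∩ K') ∩ V, w b) + (∑ b ∈ (L ∩ L') ∩ V, w b)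
          - (∑ b ∈ K, w b) * (∑ b ∈ L' ∩ V, w b) - (∑ b ∈ K', w b) * (∑ b ∈ L ∩ V, w b))
        + (1 - ∑ b ∈ V, w b) * ((∑ b ∈ P ∩ P', w b) + (∑ b ∈ K ∩ K', w b)
          - (∑ b ∈ K, w b) * (∑ b ∈ P', w b) - (∑ b ∈ P, w b) * (∑ b ∈ K', w b)) := by
  have hwV : ∀ b ∈ V, 0 ≤ w b := fun b _ => hw b
  have hpt := gtrue_pointwise w V P K L O P' K' L' O' hwV hOK hOL hKP hLP hOK' hOL' hKP' hLP'
  -- the untraced four-set modularity for the nested pairs K ⊆ P, K' ⊆ P' (take the "slot" to be everything)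
  have hmod := modularity_nested w (Finset.univ : Finset B) P K P' K' (fun b _ => hw b) hKP hKP'
  simp only [Finset.inter_univ] at hmod
  have hv1 : ∑ b ∈ V, w b ≤ 1 := by
    rw [← hw1]; exact sum_le_sum_of_subset' w hw (Finset.subset_univ V)
  have hbr : 0 ≤ (1 - ∑ b ∈ V, w b) * ((∑ b ∈ P ∩ P', w b) + (∑ b ∈ K ∩ K', w b)
          - (∑ b ∈ K, w b) * (∑ b ∈ P', w b) - (∑ b ∈ P, w b) * (∑ b ∈ K', w b)) :=
    mul_nonneg (by linarith) (by linarith)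
  linarith [hpt, hHar₁, hHar₂, hHar₃, hHar₄, hbr]

end Summit.CriticalPhenomena.PercolationContinuityZ3.Theorems.SahiE3ExchangeGTrue
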